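import Mathlib
import HarnessLib
import Literature.MathematicalPhysics.QuantumFieldTheory.ConstructiveQFTWave0
import Literature.MathematicalPhysics.QuantumFieldTheory.UnitaryCayleyChart
import Summits.Ventures.LatticeQCDFlow.Scaling.MetricTunnellingRadii

/-!
# LatticeQCDFlow / Scaling — local paths on `U(N)` (Cayley chart, explicit constants) and the `U(N)` small-step tunnelling law modulo the sector inputs (v3.1)

HONEST FRAMING: exact (Metropolis-corrected) sampling algorithms for lattice gauge theory; figures
of merit are autocorrelation/cost numbers at stated couplings and volumes; no continuum-physics
claim.

THEORY-2.md §3.3 (C2c-T) metric form.  `MetricTunnellingRadii.lean` proves, for any pseudo-metric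
space with LOCAL PATHS OF RADII `(ρ, r)` and any charge continuous off a defect set `D`,
`(μ ⊗ₘ κ){Q ≠ Q'} ≤ 2·μ(cthickening r D)` for every `μ`-invariant Markov kernel with a.s. `ρ`-small
moves.  This file discharges the geometric input for the unitary group `U(N)` with the
Hilbert–Schmidt metric and EXPLICIT constants, from the Literature Cayley chart
(`UnitaryCayley.chart`, [cite: arXiv160201222, Cor. 11.3]):

* `UN.dist_mul_left` — left invariance of the Hilbert–Schmidt distance on `U(N)`;
* **`UN.exists_localPaths`** — for `0 ≤ ρ ≤ 1/8`, `U(N)` has `(ρ, 2ρ)`-local paths: two elements at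
  distance `≤ ρ` are joined by `t ↦ U·chart(t·b)` with `chart b = U⁻¹U'`, `‖b‖ ≤ 2ρ` (the chart fills
  the ball `gball (r/κ r) ⊆ chart '' closedBall 0 r`, `κ r = (1+2r)(1+r/2)`, with `r = 2ρ`, and is
  `1`-Lipschitz: `‖chart a - 1‖ ≤ ‖a‖`);
* `UN.exists_localPaths_gaugeConfig` — hence `U(N)^E` (sup metric; `exists_localPath_pi_radii`);
* **`UN.compProd_ne_le_of_dist_le`** — the `U(N)` SMALL-STEP TUNNELLING LAW modulo the sector inputs:
  for `0 ≤ ρ ≤ 1/8`, every defect set `D`, every integer-valued charge `Q` continuous off `D` on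
  `U(N)^E`, every s-finite `m` and every `m`-invariant Markov kernel with a.s. `ρ`-small moves,
  `(m ⊗ₘ κ){Q ≠ Q'} ≤ 2·m(cthickening (2ρ) D)`.
No sorry, no new axioms, no `def`.
-/

noncomputable section

open scoped Matrix.Norms.Frobenius ENNReal ProbabilityTheory
open MeasureTheory ProbabilityTheory Metric Set
open Literature.MathematicalPhysics.QuantumFieldTheory
open Literature.MathematicalPhysics.QuantumFieldTheory.UnitaryCayley (𝔾 𝔼 gball chart)
open Summit.Ventures.LatticeQCDFlow.Theory2.Tunnelling

namespace Summit.Ventures.LatticeQCDFlow.Theory2.Lattice.UN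

variable {N : ℕ}

/-! ## §1. Left invariance of the Hilbert–Schmidt distance on `U(N)` -/

/-- `dist (U V) (U W) = dist V W` on `U(N)` (Frobenius norm is left unitarily invariant). [folklore] -/
theorem dist_mul_left (U V W : 𝔾 N) : dist (U * V) (U * W) = dist V W := by
  rw [Subtype.dist_eq, Subtype.dist_eq, dist_eq_norm, dist_eq_norm]
  have h := Matrix.frobenius_norm_unitaryGroup_mul U
    ((V : Matrix (Fin N) (Fin N) ℂ) - (W : Matrix (Fin N) (Fin N) ℂ))
  rw [Matrix.mul_sub] at h
  exact h

/-- `dist (U⁻¹ U') 1 = dist U U'`. [folklore] -/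
theorem dist_inv_mul_one (U U' : 𝔾 N) : dist (U⁻¹ * U') 1 = dist U U' := by
  have h := dist_mul_left U (U⁻¹ * U') 1
  rw [mul_inv_cancel_left, mul_one] at h
  rw [← h, dist_comm]

/-- `dist (chart a) 1 ≤ ‖a‖` (the Cayley chart is `1`-Lipschitz). [cite: arXiv160201222, Cor. 11.3] -/
theorem dist_chart_one_le (a : 𝔼 N) : dist (chart a) (1 : 𝔾 N) ≤ ‖a‖ := by
  rw [Subtype.dist_eq, dist_eq_norm, OneMemClass.coe_one]
  exact UnitaryCayley.norm_chart_sub_one_le a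

/-! ## §2. Local paths on `U(N)` from the Cayley chart -/

/-- For `0 ≤ ρ ≤ 1/8`: `ρ ≤ 2ρ/κ(2ρ)`, i.e. the Cayley chart on the `2ρ`-ball fills the `ρ`-ball of
`U(N)`. [folklore] -/
theorem le_two_mul_div_κ {ρ : ℝ} (hρ0 : 0 ≤ ρ) (hρ : ρ ≤ 1 / 8) :
    ρ ≤ 2 * ρ / UnitaryCayley.κ (2 * ρ) := by
  rw [le_div_iff₀ (UnitaryCayley.κ_pos (by positivity))]
  unfold UnitaryCayley.κ
  nlinarith [mul_nonneg hρ0 hρ0, mul_nonneg (mul_nonneg hρ0 hρ0) hρ0]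

/-- **`U(N)` has `(ρ, 2ρ)`-local paths for `0 ≤ ρ ≤ 1/8`.**  Any `U, U'` with `dist U U' ≤ ρ` are
joined by a path, continuous on `[0,1]`, inside the closed `2ρ`-ball about `U` — namely
`t ↦ U·chart(t·b)` with `chart b = U⁻¹U'`, `‖b‖ ≤ 2ρ` (`gball_subset_image_chart`,
`norm_chart_sub_one_le`). [folklore] -/
theorem exists_localPaths {ρ : ℝ} (hρ0 : 0 ≤ ρ) (hρ : ρ ≤ 1 / 8) (U U' : 𝔾 N)
    (hUU' : dist U U' ≤ ρ) :
    ∃ γ : ℝ → 𝔾 N, ContinuousOn γ (Icc (0 : ℝ) 1) ∧ γ 0 = U ∧ γ 1 = U' ∧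
      ∀ t ∈ Icc (0 : ℝ) 1, dist (γ t) U ≤ 2 * ρ := by
  -- the relative position `W = U⁻¹ U'` lies in `gball ρ ⊆ gball (2ρ/κ(2ρ)) ⊆ chart '' closedBall 0 (2ρ)`
  have hW : U⁻¹ * U' ∈ gball N ρ := by
    rw [UnitaryCayley.mem_gball]
    have h := dist_inv_mul_one U U'
    rw [Subtype.dist_eq, dist_eq_norm, OneMemClass.coe_one] at h
    rw [h]; exact hUU'
  have hfill := UnitaryCayley.gball_subset_image_chart (N := N) (r := 2 * ρ) (by positivity)
    (by linarith)
  obtain ⟨b, hb, hbW⟩ := hfill (UnitaryCayley.gball_mono (le_two_mul_div_κ hρ0 hρ) hW)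
  rw [mem_closedBall, dist_zero_right] at hb
  refine ⟨fun t => U * chart (t • b), ?_, ?_, ?_, ?_⟩
  · exact (continuous_const.mul
      (UnitaryCayley.continuous_chart.comp (continuous_id.smul continuous_const))).continuousOn
  · simp only [zero_smul, UnitaryCayley.chart_zero, mul_one]
  · simp only [one_smul, hbW, mul_inv_cancel_left]
  · intro t ht
    have h1 : dist (U * chart (t • b)) U = dist (chart (t • b)) 1 := by
      conv_lhs => rw [← mul_one U, mul_assoc, one_mul]
      rw [dist_mul_left]
    rw [h1]
    calc dist (chart (t • b)) 1 ≤ ‖t • b‖ := dist_chart_one_le (t • b)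
      _ = t * ‖b‖ := by rw [norm_smul, Real.norm_eq_abs, abs_of_nonneg ht.1]
      _ ≤ 1 * (2 * ρ) := mul_le_mul ht.2 hb (norm_nonneg _) zero_le_one
      _ = 2 * ρ := one_mul _

/-- **`U(N)^E` has `(ρ, 2ρ)`-local paths for `0 ≤ ρ ≤ 1/8`** (sup metric over links;
`exists_localPath_pi_radii`). [folklore] -/
theorem exists_localPaths_gaugeConfig {d L : ℕ} [NeZero L] {ρ : ℝ} (hρ0 : 0 ≤ ρ) (hρ : ρ ≤ 1 / 8)
    (U U' : GaugeConfig d L (𝔾 N)) (hUU' : dist U U' ≤ ρ) :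
    ∃ γ : ℝ → GaugeConfig d L (𝔾 N), ContinuousOn γ (Icc (0 : ℝ) 1) ∧ γ 0 = U ∧ γ 1 = U' ∧
      ∀ t ∈ Icc (0 : ℝ) 1, dist (γ t) U ≤ 2 * ρ :=
  exists_localPath_pi_radii (by positivity) (fun a b hab => exists_localPaths hρ0 hρ a b hab) U U' hUU'

/-! ## §3. The `U(N)` small-step tunnelling law modulo the sector inputs -/

/-- **`U(N)` small-step tunnelling law, modulo the sector inputs.**  For `0 ≤ ρ ≤ 1/8` (a universal
constant: no dependence on `N, d, L, β`), every defect set `D ⊆ U(N)^E`, every INTEGER-VALUED charge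
`Q` CONTINUOUS OFF `D`, every s-finite law `m` and every `m`-invariant Markov kernel `κ` whose moves
are a.s. `ρ`-small in the sup–Hilbert–Schmidt metric: `(m ⊗ₘ κ){Q ≠ Q'} ≤ 2·m(cthickening (2ρ) D)`.
[folklore] -/
theorem compProd_ne_le_of_dist_le {d L : ℕ} [NeZero L] {ρ : ℝ} (hρ0 : 0 ≤ ρ) (hρ : ρ ≤ 1 / 8)
    (D : Set (GaugeConfig d L (𝔾 N))) {Q : GaugeConfig d L (𝔾 N) → ℝ} (hQ : ContinuousOn Q Dᶜ)
    (hint : ∀ U, ∃ n : ℤ, Q U = n) (m : Measure (GaugeConfig d L (𝔾 N))) [SFinite m]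
    (κ : Kernel (GaugeConfig d L (𝔾 N)) (GaugeConfig d L (𝔾 N))) [IsMarkovKernel κ]
    (hinv : κ.Invariant m) (hstep : ∀ᵐ q ∂(m ⊗ₘ κ), dist q.1 q.2 ≤ ρ) :
    (m ⊗ₘ κ) {q | Q q.1 ≠ Q q.2} ≤ 2 * m (cthickening (2 * ρ) D) :=
  compProd_ne_le_two_mul_cthickening_of_localPaths_real hQ hint
    (fun a b hab => exists_localPaths_gaugeConfig hρ0 hρ a b hab) m κ hinv hstep

end Summit.Ventures.LatticeQCDFlow.Theory2.Lattice.UN
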